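import Summits.QuantumFields.YangMills.Theorems.FluctuationComparisonRegPrIntLS2BetaStrataOfGaugedLetters
import HarnessLib

/-!
# S2β ∕ GAP♯∘ strata residue (H′) — THE GAUGE-CONDITIONED LETTERS (v3): GAP♯∘ ⟸ (AX) «a residual relative gauge satisfying `Ax` exists» +
# (D-ax) «distance letter on `Ax`-pairs» + (F-ax) «pairing letter on `Ax`-pairs», for an ARBITRARY gauge-condition predicate `Ax`;
# with `Ax :=` OPTIMAL RELATIVE GAUGE the existence letter (AX) is a THEOREM

Cell `ym3-torus` (YM ladder rung R3 = continuum `SU(2)` Yang–Mills on the three-torus — a RUNG: NOT d = 4, NOT infinite volume,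
NOT a mass gap, NOT Clay).  Width seat «width 16» `ym3-torus-px16` (gen 21), FREE px helper on crux `stmt-QuantumFields-20520`
(`FluctuationComparisonRegPrIntL`), count-neutral, DEFINITION-FREE, default heartbeats.

WHY (FINDING #2 of this seat, bus 12:31Z).  ✓`…StrataOfGaugedLetters` asked the pairing letter (F♮) at EVERY argmin ∕ field pair.  At a pure-gauge pair
`U = w•U₀` over an argmin `U₀` presented in a SMOOTH (comb-axial) residual gauge, the exact split cancels term against term: `−LIN = Σ_p reTr U₀∂p·(1 − reTr E_p) ≈ REL`
while `d²(U,U₀) = Σ_ℓ dist1([g, U₀ℓ])² + O(s²)` is of the SAME order as `N²·REL` once `θ_J²·N ≳ 1` — so «`−LIN ≤ c·N⁻²d² + ¼REL` for every `c > 0`»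
is false at large depth.  Any door that lower-bounds the relative action and asks a letter for `−LIN` separately must EXCLUDE (near-)pure-gauge pairs
by a GAUGE CONDITION on the pair.  This file makes the condition an arbitrary predicate `Ax F J K hJK U U₀′` («`U` is gauge-fixed relative to `U₀′`»):
* (AX) «existence»: prefix of ✓(D10), then `∃ γ₁ > 0, ∀ F γ … ∀ U₀ ∈ argmin, ∀ U ∈ fibre ∩ histGood, ∃ w residual, Ax(U, w•U₀)`;
* (D-ax) «distance on `Ax`-pairs»: prefix, `∃ γ₁ > 0, ∃ C_D > 0, ∀ …, Ax(U,U₀) → N⁻²·d²(U,U₀) ≤ C_D·REL(U;U₀)`;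
* (F-ax) «pairing on `Ax`-pairs»: prefix, `∀ c > 0, ∃ γ₁ > 0, ∀ …, Ax(U,U₀) → −LIN(U;U₀) ≤ c·N⁻²·d²(U,U₀) + ¼·REL(U;U₀)`.
★★★ `gapStratum_of_axialLetters (G) (Ax) (hAX) (hD) (hF)` — conclusion = ✓`gapStratum_of_letters` VERBATIM (proof: `w` from (AX); `w•U₀` is again an
argmin point, ✓`gaugeAct_mem_argmin_iff_of_residual`; (D-ax)+(F-ax)+(E) there; ✓`gap_algebra`; `x ≤ N⁻²·d²(U, w•U₀)` by ✓`iInf_orbitDistSq_le_of_residual`).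
★★ `axLetter_opt (G)` — **(AX) IS A THEOREM for `Ax := OPT`**, the OPTIMAL relative gauge `∀ w′ residual, d²(U,U₀′) ≤ d²(U, w′•U₀′)` (the orbit distance is
attained on the compact residual set, ✓`exists_orbitDistSq_eq_iInf`; the residual set is a group).  ★★★ `uniformFibreGapOrbit_of_optLetters (hD₁ hF₁ hD₂ hF₂)`:
GAP♯∘ v11.4 VERBATIM ⟸ {(D-opt)_IRR, (F-opt)_IRR, (D-opt)_A′, (F-opt)_A′} — the existence debt discharged.  Which `Ax` the REL-TEL road delivers
(D-ax) in (optimal, or its own comb-axial tower gauge with its own (AX)) is the (D)-lane's call; the door serves any.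

HONEST SCOPE.  A DOOR + one compactness lemma; (D-ax), (F-ax) are HYPOTHESES (UV3-NODE §75.4∕§75.9); nothing of Bałaban's analysis is asserted or proved;
`hIrr`, `hA`, GAP♯∘ (`stub_uniformFibreGapOrbit`), S2β, the five registered stubs of `Lines/semiclassical_s2beta.lean` (3732b7df), crux 20520, 19936, 19200
and `YM3TorusSU2` are NOT proved; no registered stub is closed; the Yang–Mills mass gap is NOT proved.  Sorry-free, axioms standard.

References: T. Bałaban, CMP **102** (1985) 277–309 [Balaban1985Variational] (Thm 1 (8)–(10) p.279; (4) p.278 the residual group; (142) p.299);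
CMP **102** (1985) 255–275 [Balaban1985UV3] ((7) p.257); CMP **109** (1987) 249–301 [Balaban1987RG1] (p.256, «u = 1 on T⁽ᵏ⁾»).
-/

set_option autoImplicit false

noncomputable section

open Set Function
open scoped Matrix.Norms.L2Operator RealInnerProductSpace
open Literature.MathematicalPhysics.QuantumLattice (su2Quat)
open Literature.MathematicalPhysics.QuantumFieldTheory.Balaban1983to89
open Literature.MathematicalPhysics.QuantumFieldTheory.Balaban1983to89.T4Continuum
open Literature.MathematicalPhysics.QuantumFieldTheory.Balaban1983to89.B10Eq27TorusAxialLog (unitsField toUField)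
open Literature.MathematicalPhysics.QuantumFieldTheory.Balaban1983to89.B9AdOrthogonal (σ₃)
open Literature.MathematicalPhysics.QuantumFieldTheory.Balaban1983to89.T3ContinuumYM3Torus
open Literature.MathematicalPhysics.QuantumFieldTheory.Balaban1983to89.T3UnitLawDensityEML (ℰp)
open Literature.MathematicalPhysics.QuantumFieldTheory.Balaban1983to89.T3UnitScaleTilt
open Literature.MathematicalPhysics.QuantumFieldTheory.Balaban1983to89.T3TiltDescent
open Literature.MathematicalPhysics.QuantumFieldTheory.Balaban1983to89.T3Thresholds (exists_gamma_forall_θBal_le)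
open Literature.MathematicalPhysics.QuantumFieldTheory.Balaban1983to89.T3ConstrainedMinimiser (fibre)
open Literature.MathematicalPhysics.QuantumFieldTheory.Balaban1983to89.T3PrintedRegularMinimiser
open Literature.MathematicalPhysics.QuantumFieldTheory.Balaban1983to89.T3PrintedRegularOrbits
open Literature.MathematicalPhysics.QuantumFieldTheory.Balaban1983to89.T4ExpWindowSmallField (imVec)
open Summit.QuantumFields.YangMills.Theorems.FluctuationComparisonRegPrIntLS2BetaExcessSplit (relAction_le_excess_sub_lin)
open Summit.QuantumFields.YangMills.Theorems.FluctuationComparisonRegPrIntLS2BetaGapOrbitOfStrataTwo (uniformFibreGapOrbit_of_strata)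
open Summit.QuantumFields.YangMills.Theorems.FluctuationComparisonRegPrIntLS2BetaStrataOfLetters (gap_algebra dist1_plaqHol_lt_of_mem_histGood_zero)
open Summit.QuantumFields.YangMills.Theorems.FluctuationComparisonRegPrIntLS2BetaResidualGauge (gaugeAct_mem_argmin_iff_of_residual residual_mul
  gaugeAct_mul_eq)
open Summit.QuantumFields.YangMills.Theorems.FluctuationComparisonRegPrIntLS2BetaResidualGaugeOrbit (exists_orbitDistSq_eq_iInf)
open Summit.QuantumFields.YangMills.Theorems.FluctuationComparisonRegPrIntLS2BetaOrbitDistComparison (iInf_orbitDistSq_le_of_residual)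

namespace Summit.QuantumFields.YangMills.Theorems.FluctuationComparisonRegPrIntLS2BetaStrataOfAxialLetters

/-! ## §1 The door with an arbitrary stratum guard and an arbitrary gauge condition -/

/-- ★★★ **THE STRATUM GAP BODY FROM THE GAUGE-CONDITIONED LETTERS (AX) + (D-ax) + (F-ax), ARBITRARY GUARD `G` AND GAUGE CONDITION `Ax`.**
Conclusion = ✓`…S2BetaStrataOfLetters.gapStratum_of_letters` VERBATIM; `μ := 1∕(2C_D)`.
[cite: Balaban1985Variational, Thm 1 (8)-(10) p.279, (4) p.278, (142) p.299; Balaban1985UV3, (7) p.257] -/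
theorem gapStratum_of_axialLetters
    (G : (F : T3Family) → (J : ℕ) → GaugeField (F.P J) 0 (Matrix.specialUnitaryGroup (Fin 2) ℂ) → Prop)
    (Ax : (F : T3Family) → (J K : ℕ) → (hJK : J ≤ K) → GaugeField (F.P K) 0 (Matrix.specialUnitaryGroup (Fin 2) ℂ) →
      GaugeField (F.P K) 0 (Matrix.specialUnitaryGroup (Fin 2) ℂ) → Prop)
    (hAX : ∀ (L : ℕ), ∃ c₀ : ℝ, 0 < c₀ ∧ c₀ ≤ 1 ∧ ∀ (cw : ℝ), 0 < cw → cw ≤ c₀ → ∃ pS : ℝ, ∀ (b₀ p₀ : ℝ), 0 < b₀ → pS ≤ p₀ → 0 < p₀ → ∃ ε₁ : ℝ, 0 < ε₁ ∧ ∀ (ε₀ : ℝ), 0 < ε₀ → ε₀ ≤ ε₁ →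
    ∃ γ₁ : ℝ, 0 < γ₁ ∧ ∀ (F : T3Family) (γ : ℝ), F.L = L → 0 < γ → γ ≤ γ₁ →
      ∀ (J K : ℕ) (hJK : J ≤ K) (V : GaugeField (F.P J) 0 (Matrix.specialUnitaryGroup (Fin 2) ℂ)), PlaqSmall (θBal F.L γ (cw * b₀) p₀ J) V →
        G F J V →
        ∀ U₀ ∈ {U' : GaugeField (F.P K) 0 (Matrix.specialUnitaryGroup (Fin 2) ℂ) | U' ∈ fibre F ℰp J K hJK V ∧ U' ∈ histGood F ℰp (θBal F.L γ b₀ p₀) K J ∧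
            wilsonAction4 U' = minActionRegPr F J K hJK ε₀ V},
        ∀ U ∈ fibre F ℰp J K hJK V, U ∈ histGood F ℰp (θBal F.L γ b₀ p₀) K J →
          ∃ w : GaugeTransf (F.P K) 0 (Matrix.specialUnitaryGroup (Fin 2) ℂ),
            (∀ U' : GaugeField (F.P K) 0 (Matrix.specialUnitaryGroup (Fin 2) ℂ),
              descendTo F ℰp J K hJK (GaugeField.gaugeAct w U') = descendTo F ℰp J K hJK U') ∧
            Ax F J K hJK U (GaugeField.gaugeAct w U₀))
    (hD : ∀ (L : ℕ), ∃ c₀ : ℝ, 0 < c₀ ∧ c₀ ≤ 1 ∧ ∀ (cw : ℝ), 0 < cw → cw ≤ c₀ → ∃ pS : ℝ, ∀ (b₀ p₀ : ℝ), 0 < b₀ → pS ≤ p₀ → 0 < p₀ → ∃ ε₁ : ℝ, 0 < ε₁ ∧ ∀ (ε₀ : ℝ), 0 < ε₀ → ε₀ ≤ ε₁ →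
    ∃ γ₁ : ℝ, 0 < γ₁ ∧ ∃ C_D : ℝ, 0 < C_D ∧ ∀ (F : T3Family) (γ : ℝ), F.L = L → 0 < γ → γ ≤ γ₁ →
      ∀ (J K : ℕ) (hJK : J ≤ K) (V : GaugeField (F.P J) 0 (Matrix.specialUnitaryGroup (Fin 2) ℂ)), PlaqSmall (θBal F.L γ (cw * b₀) p₀ J) V →
        G F J V →
        ∀ U₀ ∈ {U' : GaugeField (F.P K) 0 (Matrix.specialUnitaryGroup (Fin 2) ℂ) | U' ∈ fibre F ℰp J K hJK V ∧ U' ∈ histGood F ℰp (θBal F.L γ b₀ p₀) K J ∧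
            wilsonAction4 U' = minActionRegPr F J K hJK ε₀ V},
        ∀ U ∈ fibre F ℰp J K hJK V, U ∈ histGood F ℰp (θBal F.L γ b₀ p₀) K J →
          Ax F J K hJK U U₀ →
          ((F.L : ℝ)⁻¹) ^ (2 * (K - J)) * ∑ ℓ : PBond (F.P K) 0, dist1 (U ℓ * (U₀ ℓ)⁻¹) ^ 2
            ≤ C_D * ∑ p : Plaq (F.P K) 0, (1 - reTr ((GaugeField.plaqHol U₀ p)⁻¹ * GaugeField.plaqHol U p)))
    (hF : ∀ (L : ℕ), ∃ c₀ : ℝ, 0 < c₀ ∧ c₀ ≤ 1 ∧ ∀ (cw : ℝ), 0 < cw → cw ≤ c₀ → ∃ pS : ℝ, ∀ (b₀ p₀ : ℝ), 0 < b₀ → pS ≤ p₀ → 0 < p₀ → ∃ ε₁ : ℝ, 0 < ε₁ ∧ ∀ (ε₀ : ℝ), 0 < ε₀ → ε₀ ≤ ε₁ →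
    ∀ (c : ℝ), 0 < c → ∃ γ₁ : ℝ, 0 < γ₁ ∧ ∀ (F : T3Family) (γ : ℝ), F.L = L → 0 < γ → γ ≤ γ₁ →
      ∀ (J K : ℕ) (hJK : J ≤ K) (V : GaugeField (F.P J) 0 (Matrix.specialUnitaryGroup (Fin 2) ℂ)), PlaqSmall (θBal F.L γ (cw * b₀) p₀ J) V →
        G F J V →
        ∀ U₀ ∈ {U' : GaugeField (F.P K) 0 (Matrix.specialUnitaryGroup (Fin 2) ℂ) | U' ∈ fibre F ℰp J K hJK V ∧ U' ∈ histGood F ℰp (θBal F.L γ b₀ p₀) K J ∧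
            wilsonAction4 U' = minActionRegPr F J K hJK ε₀ V},
        ∀ U ∈ fibre F ℰp J K hJK V, U ∈ histGood F ℰp (θBal F.L γ b₀ p₀) K J →
          Ax F J K hJK U U₀ →
          -(∑ p : Plaq (F.P K) 0,
              inner ℝ (imVec (su2Quat (GaugeField.plaqHol U₀ p))) (imVec (su2Quat ((GaugeField.plaqHol U₀ p)⁻¹ * GaugeField.plaqHol U p))))
            ≤ c * (((F.L : ℝ)⁻¹) ^ (2 * (K - J)) * ∑ ℓ : PBond (F.P K) 0, dist1 (U ℓ * (U₀ ℓ)⁻¹) ^ 2) +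
              1 / 4 * ∑ p : Plaq (F.P K) 0, (1 - reTr ((GaugeField.plaqHol U₀ p)⁻¹ * GaugeField.plaqHol U p))) :
    ∀ (L : ℕ), ∃ c₀ : ℝ, 0 < c₀ ∧ c₀ ≤ 1 ∧ ∀ (cw : ℝ), 0 < cw → cw ≤ c₀ → ∃ pS : ℝ, ∀ (b₀ p₀ : ℝ), 0 < b₀ → pS ≤ p₀ → 0 < p₀ → ∃ ε₁ : ℝ, 0 < ε₁ ∧ ∀ (ε₀ : ℝ), 0 < ε₀ → ε₀ ≤ ε₁ →
    ∃ γ₁ : ℝ, 0 < γ₁ ∧ ∃ μ : ℝ, 0 < μ ∧ ∀ (F : T3Family) (γ : ℝ), F.L = L → 0 < γ → γ ≤ γ₁ →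
      ∀ (J K : ℕ) (hJK : J ≤ K) (V : GaugeField (F.P J) 0 (Matrix.specialUnitaryGroup (Fin 2) ℂ)), PlaqSmall (θBal F.L γ (cw * b₀) p₀ J) V →
        G F J V →
        ∀ U₀ ∈ {U' : GaugeField (F.P K) 0 (Matrix.specialUnitaryGroup (Fin 2) ℂ) | U' ∈ fibre F ℰp J K hJK V ∧ U' ∈ histGood F ℰp (θBal F.L γ b₀ p₀) K J ∧
            wilsonAction4 U' = minActionRegPr F J K hJK ε₀ V},
        ∀ U ∈ fibre F ℰp J K hJK V, U ∈ histGood F ℰp (θBal F.L γ b₀ p₀) K J →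
          μ * ((F.L : ℝ)⁻¹) ^ (2 * (K - J)) *
              (⨅ w : {w : GaugeTransf (F.P K) 0 (Matrix.specialUnitaryGroup (Fin 2) ℂ) | ∀ U : GaugeField (F.P K) 0 (Matrix.specialUnitaryGroup (Fin 2) ℂ),
                  descendTo F ℰp J K hJK (GaugeField.gaugeAct w U) = descendTo F ℰp J K hJK U}, ∑ ℓ : PBond (F.P K) 0,
                dist1 (U ℓ * ((GaugeField.gaugeAct (w : GaugeTransf (F.P K) 0 (Matrix.specialUnitaryGroup (Fin 2) ℂ)) U₀) ℓ)⁻¹) ^ 2)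
            ≤ wilsonAction4 U - minActionRegPr F J K hJK ε₀ V := by
  intro L
  obtain ⟨c₀', hc₀', -, H0⟩ := hAX L
  obtain ⟨c₁, hc₁, hc₁1, H1⟩ := hD L
  obtain ⟨c₂, hc₂, -, H2⟩ := hF L
  refine ⟨min c₁ (min c₂ c₀'), lt_min hc₁ (lt_min hc₂ hc₀'), (min_le_left _ _).trans hc₁1, ?_⟩
  intro cw hcw hcwle
  obtain ⟨pS₀, H0⟩ := H0 cw hcw (hcwle.trans ((min_le_right _ _).trans (min_le_right _ _)))
  obtain ⟨pS₁, H1⟩ := H1 cw hcw (hcwle.trans (min_le_left _ _))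
  obtain ⟨pS₂, H2⟩ := H2 cw hcw (hcwle.trans ((min_le_right _ _).trans (min_le_left _ _)))
  refine ⟨max pS₁ (max pS₂ pS₀), ?_⟩
  intro b₀ p₀ hb hpS hp
  obtain ⟨e₀, he₀, H0⟩ := H0 b₀ p₀ hb ((le_max_right _ _).trans ((le_max_right _ _).trans hpS)) hp
  obtain ⟨e₁, he₁, H1⟩ := H1 b₀ p₀ hb ((le_max_left _ _).trans hpS) hp
  obtain ⟨e₂, he₂, H2⟩ := H2 b₀ p₀ hb ((le_max_left _ _).trans ((le_max_right _ _).trans hpS)) hp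
  refine ⟨min e₁ (min e₂ e₀), lt_min he₁ (lt_min he₂ he₀), ?_⟩
  intro ε₀ hε₀ hε₀le
  obtain ⟨γA, hγA, H0⟩ := H0 ε₀ hε₀ (hε₀le.trans ((min_le_right _ _).trans (min_le_right _ _)))
  obtain ⟨γD, hγD, C_D, hCD, H1⟩ := H1 ε₀ hε₀ (hε₀le.trans (min_le_left _ _))
  obtain ⟨γF, hγF, H2⟩ := H2 ε₀ hε₀ (hε₀le.trans ((min_le_right _ _).trans (min_le_left _ _))) (1 / (16 * C_D)) (by positivity)
  obtain ⟨γc, hγc, -, hθ⟩ := exists_gamma_forall_θBal_le (b₀ := b₀) (p₀ := p₀) hb hp (σ := 1 / 2) (by norm_num)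
  refine ⟨min γD (min γF (min γA γc)), lt_min hγD (lt_min hγF (lt_min hγA hγc)), 1 / (2 * C_D), by positivity, ?_⟩
  intro F γ hFL hγ hγle J K hJK V hV hG U₀ hU₀ U hU hUg
  -- (AX): a residual `w` putting the pair in the gauge condition; move the background along its residual orbit
  obtain ⟨w, hw, hAx⟩ := H0 F γ hFL hγ (hγle.trans ((min_le_right _ _).trans ((min_le_right _ _).trans (min_le_left _ _))))
    J K hJK V hV hG U₀ hU₀ U hU hUg
  have hU₀' : GaugeField.gaugeAct w U₀ ∈ {U' : GaugeField (F.P K) 0 (Matrix.specialUnitaryGroup (Fin 2) ℂ) | U' ∈ fibre F ℰp J K hJK V ∧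
      U' ∈ histGood F ℰp (θBal F.L γ b₀ p₀) K J ∧ wilsonAction4 U' = minActionRegPr F J K hJK ε₀ V} :=
    (gaugeAct_mem_argmin_iff_of_residual F hJK hw U₀ V).mpr hU₀
  -- (F♮) at the moved background
  have hDx := H1 F γ hFL hγ (hγle.trans (min_le_left _ _)) J K hJK V hV hG _ hU₀' U hU hUg hAx
  have hFx := H2 F γ hFL hγ (hγle.trans ((min_le_right _ _).trans (min_le_left _ _))) J K hJK V hV hG _ hU₀' U hU hUg hAx
  -- (E): the moved background's finest plaquettes are `≤ ½` (good history at level 0, `θBal(K) ≤ ½` for `γ ≤ γc`)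
  have hθU₀ : ∀ p, dist1 (GaugeField.plaqHol (GaugeField.gaugeAct w U₀) p) ≤ 1 / 2 := fun p =>
    (dist1_plaqHol_lt_of_mem_histGood_zero F hJK (θBal F.L γ b₀ p₀) hU₀'.2.1 p).le.trans
      (hθ F.L F.hL.2.le γ hγ (hγle.trans ((min_le_right _ _).trans ((min_le_right _ _).trans (min_le_right _ _)))) K)
  have hE := relAction_le_excess_sub_lin U (GaugeField.gaugeAct w U₀) hθU₀
  -- the four-line algebra at the moved pair, then `x ≤ N⁻²·d²(U, w•U₀)`
  have hp0 : (0 : ℝ) ≤ ((F.L : ℝ)⁻¹) ^ (2 * (K - J)) := pow_nonneg (inv_nonneg.mpr (Nat.cast_nonneg _)) _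
  have hy : (0 : ℝ) ≤ ∑ ℓ : PBond (F.P K) 0, dist1 (U ℓ * ((GaugeField.gaugeAct w U₀) ℓ)⁻¹) ^ 2 :=
    Finset.sum_nonneg fun _ _ => sq_nonneg _
  have key := gap_algebra hCD (mul_nonneg hp0 hy) hDx hE hFx
  have hxy : (⨅ w : {w : GaugeTransf (F.P K) 0 (Matrix.specialUnitaryGroup (Fin 2) ℂ) | ∀ U : GaugeField (F.P K) 0 (Matrix.specialUnitaryGroup (Fin 2) ℂ),
                  descendTo F ℰp J K hJK (GaugeField.gaugeAct w U) = descendTo F ℰp J K hJK U}, ∑ ℓ : PBond (F.P K) 0,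
                dist1 (U ℓ * ((GaugeField.gaugeAct (w : GaugeTransf (F.P K) 0 (Matrix.specialUnitaryGroup (Fin 2) ℂ)) U₀) ℓ)⁻¹) ^ 2)
      ≤ ∑ ℓ : PBond (F.P K) 0, dist1 (U ℓ * ((GaugeField.gaugeAct w U₀) ℓ)⁻¹) ^ 2 :=
    iInf_orbitDistSq_le_of_residual F hJK U U₀ hw
  rw [mul_assoc, ← hU₀'.2.2]
  have hμ : (0 : ℝ) ≤ 1 / (2 * C_D) := by positivity
  calc 1 / (2 * C_D) * (((F.L : ℝ)⁻¹) ^ (2 * (K - J)) *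
          ⨅ w : {w : GaugeTransf (F.P K) 0 (Matrix.specialUnitaryGroup (Fin 2) ℂ) | ∀ U : GaugeField (F.P K) 0 (Matrix.specialUnitaryGroup (Fin 2) ℂ),
                  descendTo F ℰp J K hJK (GaugeField.gaugeAct w U) = descendTo F ℰp J K hJK U}, ∑ ℓ : PBond (F.P K) 0,
                dist1 (U ℓ * ((GaugeField.gaugeAct (w : GaugeTransf (F.P K) 0 (Matrix.specialUnitaryGroup (Fin 2) ℂ)) U₀) ℓ)⁻¹) ^ 2)
        ≤ 1 / (2 * C_D) * (((F.L : ℝ)⁻¹) ^ (2 * (K - J)) * ∑ ℓ : PBond (F.P K) 0, dist1 (U ℓ * ((GaugeField.gaugeAct w U₀) ℓ)⁻¹) ^ 2) :=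
        mul_le_mul_of_nonneg_left (mul_le_mul_of_nonneg_left hxy hp0) hμ
    _ ≤ wilsonAction4 U - wilsonAction4 (GaugeField.gaugeAct w U₀) := key

/-! ## §2 The optimal relative gauge: (AX) is a theorem -/

/-- ★★ **(AX) FOR THE OPTIMAL RELATIVE GAUGE IS A THEOREM**: for every pair, some residual `w` MINIMISES `w′ ↦ d²(U, w′•U₀)` over the residual set
(compact, ✓`exists_orbitDistSq_eq_iInf`; a group, ✓`residual_mul`), i.e. `Ax := OPT` «`∀ w′ residual, d²(U, U₀′) ≤ d²(U, w′•U₀′)`» at `U₀′ := w•U₀`.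
The registry prefix is threaded with trivial witnesses. [cite: Balaban1985Variational, (4) p.278, (10) p.279; Balaban1987RG1, p.256] -/
theorem axLetter_opt (G : (F : T3Family) → (J : ℕ) → GaugeField (F.P J) 0 (Matrix.specialUnitaryGroup (Fin 2) ℂ) → Prop) :
    ∀ (L : ℕ), ∃ c₀ : ℝ, 0 < c₀ ∧ c₀ ≤ 1 ∧ ∀ (cw : ℝ), 0 < cw → cw ≤ c₀ → ∃ pS : ℝ, ∀ (b₀ p₀ : ℝ), 0 < b₀ → pS ≤ p₀ → 0 < p₀ → ∃ ε₁ : ℝ, 0 < ε₁ ∧ ∀ (ε₀ : ℝ), 0 < ε₀ → ε₀ ≤ ε₁ →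
    ∃ γ₁ : ℝ, 0 < γ₁ ∧ ∀ (F : T3Family) (γ : ℝ), F.L = L → 0 < γ → γ ≤ γ₁ →
      ∀ (J K : ℕ) (hJK : J ≤ K) (V : GaugeField (F.P J) 0 (Matrix.specialUnitaryGroup (Fin 2) ℂ)), PlaqSmall (θBal F.L γ (cw * b₀) p₀ J) V →
        G F J V →
        ∀ U₀ ∈ {U' : GaugeField (F.P K) 0 (Matrix.specialUnitaryGroup (Fin 2) ℂ) | U' ∈ fibre F ℰp J K hJK V ∧ U' ∈ histGood F ℰp (θBal F.L γ b₀ p₀) K J ∧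
            wilsonAction4 U' = minActionRegPr F J K hJK ε₀ V},
        ∀ U ∈ fibre F ℰp J K hJK V, U ∈ histGood F ℰp (θBal F.L γ b₀ p₀) K J →
          ∃ w : GaugeTransf (F.P K) 0 (Matrix.specialUnitaryGroup (Fin 2) ℂ),
            (∀ U' : GaugeField (F.P K) 0 (Matrix.specialUnitaryGroup (Fin 2) ℂ),
              descendTo F ℰp J K hJK (GaugeField.gaugeAct w U') = descendTo F ℰp J K hJK U') ∧
            ∀ w' : GaugeTransf (F.P K) 0 (Matrix.specialUnitaryGroup (Fin 2) ℂ),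
              (∀ U' : GaugeField (F.P K) 0 (Matrix.specialUnitaryGroup (Fin 2) ℂ),
                descendTo F ℰp J K hJK (GaugeField.gaugeAct w' U') = descendTo F ℰp J K hJK U') →
              ∑ ℓ : PBond (F.P K) 0, dist1 (U ℓ * ((GaugeField.gaugeAct w U₀) ℓ)⁻¹) ^ 2 ≤
                ∑ ℓ : PBond (F.P K) 0, dist1 (U ℓ * ((GaugeField.gaugeAct w' (GaugeField.gaugeAct w U₀)) ℓ)⁻¹) ^ 2 := by
  intro L
  refine ⟨1, one_pos, le_rfl, ?_⟩
  intro cw _ _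
  refine ⟨0, ?_⟩
  intro b₀ p₀ _ _ _
  refine ⟨1, one_pos, ?_⟩
  intro ε₀ _ _
  refine ⟨1, one_pos, ?_⟩
  intro F γ _ _ _ J K hJK V _ _ U₀ _ U _ _
  obtain ⟨w₀, hw₀⟩ := exists_orbitDistSq_eq_iInf F hJK U U₀
  refine ⟨w₀.1, w₀.2, ?_⟩
  intro w' hw'
  have h := iInf_orbitDistSq_le_of_residual F hJK U U₀ (residual_mul F hJK hw' w₀.2)
  rw [gaugeAct_mul_eq] at h
  exact (le_of_eq hw₀).trans h

/-! ## §3 GAP♯∘ from the four optimal-gauge letters -/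

/-- ★★★ **GAP♯∘ (`UniformFibreGapOrbit`, v11.4 text VERBATIM) ⟸ {(D-opt)_IRR, (F-opt)_IRR, (D-opt)_A′, (F-opt)_A′}** — the gauge-conditioned letters
at the OPTIMAL relative gauge on the two strata, existence discharged by `axLetter_opt`; one term through ✓`uniformFibreGapOrbit_of_strata`.
[cite: Balaban1985Variational, Thm 1 (8)-(10) p.279, (4) p.278, (142) p.299, Prop. 7 p.299; Balaban1985UV3, (7) p.257] -/
theorem uniformFibreGapOrbit_of_optLetters
    (hD₁ : ∀ (L : ℕ), ∃ c₀ : ℝ, 0 < c₀ ∧ c₀ ≤ 1 ∧ ∀ (cw : ℝ), 0 < cw → cw ≤ c₀ → ∃ pS : ℝ, ∀ (b₀ p₀ : ℝ), 0 < b₀ → pS ≤ p₀ → 0 < p₀ → ∃ ε₁ : ℝ, 0 < ε₁ ∧ ∀ (ε₀ : ℝ), 0 < ε₀ → ε₀ ≤ ε₁ →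
    ∃ γ₁ : ℝ, 0 < γ₁ ∧ ∃ C_D : ℝ, 0 < C_D ∧ ∀ (F : T3Family) (γ : ℝ), F.L = L → 0 < γ → γ ≤ γ₁ →
      ∀ (J K : ℕ) (hJK : J ≤ K) (V : GaugeField (F.P J) 0 (Matrix.specialUnitaryGroup (Fin 2) ℂ)), PlaqSmall (θBal F.L γ (cw * b₀) p₀ J) V →
        (∀ c : Site (F.P J) 0 → Matrix (Fin 2) (Fin 2) ℂ,
          (∀ e : PBond (F.P J) 0, c e.src = ((unitsField (toUField V) e : (Matrix (Fin 2) (Fin 2) ℂ)ˣ) : Matrix (Fin 2) (Fin 2) ℂ) * c e.tgt *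
            (((unitsField (toUField V) e)⁻¹ : (Matrix (Fin 2) (Fin 2) ℂ)ˣ) : Matrix (Fin 2) (Fin 2) ℂ)) →
          ∃ z : ℂ, ∀ y, c y = z • (1 : Matrix (Fin 2) (Fin 2) ℂ)) →
        ∀ U₀ ∈ {U' : GaugeField (F.P K) 0 (Matrix.specialUnitaryGroup (Fin 2) ℂ) | U' ∈ fibre F ℰp J K hJK V ∧ U' ∈ histGood F ℰp (θBal F.L γ b₀ p₀) K J ∧
            wilsonAction4 U' = minActionRegPr F J K hJK ε₀ V},
        ∀ U ∈ fibre F ℰp J K hJK V, U ∈ histGood F ℰp (θBal F.L γ b₀ p₀) K J →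
          (∀ w' : GaugeTransf (F.P K) 0 (Matrix.specialUnitaryGroup (Fin 2) ℂ),
            (∀ U' : GaugeField (F.P K) 0 (Matrix.specialUnitaryGroup (Fin 2) ℂ),
              descendTo F ℰp J K hJK (GaugeField.gaugeAct w' U') = descendTo F ℰp J K hJK U') →
            ∑ ℓ : PBond (F.P K) 0, dist1 (U ℓ * (U₀ ℓ)⁻¹) ^ 2 ≤
              ∑ ℓ : PBond (F.P K) 0, dist1 (U ℓ * ((GaugeField.gaugeAct w' U₀) ℓ)⁻¹) ^ 2) →
          ((F.L : ℝ)⁻¹) ^ (2 * (K - J)) * ∑ ℓ : PBond (F.P K) 0, dist1 (U ℓ * (U₀ ℓ)⁻¹) ^ 2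
            ≤ C_D * ∑ p : Plaq (F.P K) 0, (1 - reTr ((GaugeField.plaqHol U₀ p)⁻¹ * GaugeField.plaqHol U p)))
    (hF₁ : ∀ (L : ℕ), ∃ c₀ : ℝ, 0 < c₀ ∧ c₀ ≤ 1 ∧ ∀ (cw : ℝ), 0 < cw → cw ≤ c₀ → ∃ pS : ℝ, ∀ (b₀ p₀ : ℝ), 0 < b₀ → pS ≤ p₀ → 0 < p₀ → ∃ ε₁ : ℝ, 0 < ε₁ ∧ ∀ (ε₀ : ℝ), 0 < ε₀ → ε₀ ≤ ε₁ →
    ∀ (c : ℝ), 0 < c → ∃ γ₁ : ℝ, 0 < γ₁ ∧ ∀ (F : T3Family) (γ : ℝ), F.L = L → 0 < γ → γ ≤ γ₁ →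
      ∀ (J K : ℕ) (hJK : J ≤ K) (V : GaugeField (F.P J) 0 (Matrix.specialUnitaryGroup (Fin 2) ℂ)), PlaqSmall (θBal F.L γ (cw * b₀) p₀ J) V →
        (∀ c : Site (F.P J) 0 → Matrix (Fin 2) (Fin 2) ℂ,
          (∀ e : PBond (F.P J) 0, c e.src = ((unitsField (toUField V) e : (Matrix (Fin 2) (Fin 2) ℂ)ˣ) : Matrix (Fin 2) (Fin 2) ℂ) * c e.tgt *
            (((unitsField (toUField V) e)⁻¹ : (Matrix (Fin 2) (Fin 2) ℂ)ˣ) : Matrix (Fin 2) (Fin 2) ℂ)) →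
          ∃ z : ℂ, ∀ y, c y = z • (1 : Matrix (Fin 2) (Fin 2) ℂ)) →
        ∀ U₀ ∈ {U' : GaugeField (F.P K) 0 (Matrix.specialUnitaryGroup (Fin 2) ℂ) | U' ∈ fibre F ℰp J K hJK V ∧ U' ∈ histGood F ℰp (θBal F.L γ b₀ p₀) K J ∧
            wilsonAction4 U' = minActionRegPr F J K hJK ε₀ V},
        ∀ U ∈ fibre F ℰp J K hJK V, U ∈ histGood F ℰp (θBal F.L γ b₀ p₀) K J →
          (∀ w' : GaugeTransf (F.P K) 0 (Matrix.specialUnitaryGroup (Fin 2) ℂ),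
            (∀ U' : GaugeField (F.P K) 0 (Matrix.specialUnitaryGroup (Fin 2) ℂ),
              descendTo F ℰp J K hJK (GaugeField.gaugeAct w' U') = descendTo F ℰp J K hJK U') →
            ∑ ℓ : PBond (F.P K) 0, dist1 (U ℓ * (U₀ ℓ)⁻¹) ^ 2 ≤
              ∑ ℓ : PBond (F.P K) 0, dist1 (U ℓ * ((GaugeField.gaugeAct w' U₀) ℓ)⁻¹) ^ 2) →
          -(∑ p : Plaq (F.P K) 0,
              inner ℝ (imVec (su2Quat (GaugeField.plaqHol U₀ p))) (imVec (su2Quat ((GaugeField.plaqHol U₀ p)⁻¹ * GaugeField.plaqHol U p))))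
            ≤ c * (((F.L : ℝ)⁻¹) ^ (2 * (K - J)) * ∑ ℓ : PBond (F.P K) 0, dist1 (U ℓ * (U₀ ℓ)⁻¹) ^ 2) +
              1 / 4 * ∑ p : Plaq (F.P K) 0, (1 - reTr ((GaugeField.plaqHol U₀ p)⁻¹ * GaugeField.plaqHol U p)))
    (hD₂ : ∀ (L : ℕ), ∃ c₀ : ℝ, 0 < c₀ ∧ c₀ ≤ 1 ∧ ∀ (cw : ℝ), 0 < cw → cw ≤ c₀ → ∃ pS : ℝ, ∀ (b₀ p₀ : ℝ), 0 < b₀ → pS ≤ p₀ → 0 < p₀ → ∃ ε₁ : ℝ, 0 < ε₁ ∧ ∀ (ε₀ : ℝ), 0 < ε₀ → ε₀ ≤ ε₁ →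
    ∃ γ₁ : ℝ, 0 < γ₁ ∧ ∃ C_D : ℝ, 0 < C_D ∧ ∀ (F : T3Family) (γ : ℝ), F.L = L → 0 < γ → γ ≤ γ₁ →
      ∀ (J K : ℕ) (hJK : J ≤ K) (V : GaugeField (F.P J) 0 (Matrix.specialUnitaryGroup (Fin 2) ℂ)), PlaqSmall (θBal F.L γ (cw * b₀) p₀ J) V →
        (∃ g : GaugeTransf (F.P J) 0 (Matrix.specialUnitaryGroup (Fin 2) ℂ),
          (∀ e : PBond (F.P J) 0, Commute (((GaugeField.gaugeAct g V) e : Matrix.specialUnitaryGroup (Fin 2) ℂ) : Matrix (Fin 2) (Fin 2) ℂ) σ₃) ∧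
          ∀ c : Site (F.P J) 0 → Matrix (Fin 2) (Fin 2) ℂ,
            (∀ e : PBond (F.P J) 0, c e.src = ((unitsField (toUField (GaugeField.gaugeAct g V)) e : (Matrix (Fin 2) (Fin 2) ℂ)ˣ) : Matrix (Fin 2) (Fin 2) ℂ) * c e.tgt *
            (((unitsField (toUField (GaugeField.gaugeAct g V)) e)⁻¹ : (Matrix (Fin 2) (Fin 2) ℂ)ˣ) : Matrix (Fin 2) (Fin 2) ℂ)) →
            ∃ c₀ : Matrix (Fin 2) (Fin 2) ℂ, (∀ y, c y = c₀) ∧ Commute c₀ σ₃) →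
        ∀ U₀ ∈ {U' : GaugeField (F.P K) 0 (Matrix.specialUnitaryGroup (Fin 2) ℂ) | U' ∈ fibre F ℰp J K hJK V ∧ U' ∈ histGood F ℰp (θBal F.L γ b₀ p₀) K J ∧
            wilsonAction4 U' = minActionRegPr F J K hJK ε₀ V},
        ∀ U ∈ fibre F ℰp J K hJK V, U ∈ histGood F ℰp (θBal F.L γ b₀ p₀) K J →
          (∀ w' : GaugeTransf (F.P K) 0 (Matrix.specialUnitaryGroup (Fin 2) ℂ),
            (∀ U' : GaugeField (F.P K) 0 (Matrix.specialUnitaryGroup (Fin 2) ℂ),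
              descendTo F ℰp J K hJK (GaugeField.gaugeAct w' U') = descendTo F ℰp J K hJK U') →
            ∑ ℓ : PBond (F.P K) 0, dist1 (U ℓ * (U₀ ℓ)⁻¹) ^ 2 ≤
              ∑ ℓ : PBond (F.P K) 0, dist1 (U ℓ * ((GaugeField.gaugeAct w' U₀) ℓ)⁻¹) ^ 2) →
          ((F.L : ℝ)⁻¹) ^ (2 * (K - J)) * ∑ ℓ : PBond (F.P K) 0, dist1 (U ℓ * (U₀ ℓ)⁻¹) ^ 2
            ≤ C_D * ∑ p : Plaq (F.P K) 0, (1 - reTr ((GaugeField.plaqHol U₀ p)⁻¹ * GaugeField.plaqHol U p)))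
    (hF₂ : ∀ (L : ℕ), ∃ c₀ : ℝ, 0 < c₀ ∧ c₀ ≤ 1 ∧ ∀ (cw : ℝ), 0 < cw → cw ≤ c₀ → ∃ pS : ℝ, ∀ (b₀ p₀ : ℝ), 0 < b₀ → pS ≤ p₀ → 0 < p₀ → ∃ ε₁ : ℝ, 0 < ε₁ ∧ ∀ (ε₀ : ℝ), 0 < ε₀ → ε₀ ≤ ε₁ →
    ∀ (c : ℝ), 0 < c → ∃ γ₁ : ℝ, 0 < γ₁ ∧ ∀ (F : T3Family) (γ : ℝ), F.L = L → 0 < γ → γ ≤ γ₁ →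
      ∀ (J K : ℕ) (hJK : J ≤ K) (V : GaugeField (F.P J) 0 (Matrix.specialUnitaryGroup (Fin 2) ℂ)), PlaqSmall (θBal F.L γ (cw * b₀) p₀ J) V →
        (∃ g : GaugeTransf (F.P J) 0 (Matrix.specialUnitaryGroup (Fin 2) ℂ),
          (∀ e : PBond (F.P J) 0, Commute (((GaugeField.gaugeAct g V) e : Matrix.specialUnitaryGroup (Fin 2) ℂ) : Matrix (Fin 2) (Fin 2) ℂ) σ₃) ∧
          ∀ c : Site (F.P J) 0 → Matrix (Fin 2) (Fin 2) ℂ,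
            (∀ e : PBond (F.P J) 0, c e.src = ((unitsField (toUField (GaugeField.gaugeAct g V)) e : (Matrix (Fin 2) (Fin 2) ℂ)ˣ) : Matrix (Fin 2) (Fin 2) ℂ) * c e.tgt *
            (((unitsField (toUField (GaugeField.gaugeAct g V)) e)⁻¹ : (Matrix (Fin 2) (Fin 2) ℂ)ˣ) : Matrix (Fin 2) (Fin 2) ℂ)) →
            ∃ c₀ : Matrix (Fin 2) (Fin 2) ℂ, (∀ y, c y = c₀) ∧ Commute c₀ σ₃) →
        ∀ U₀ ∈ {U' : GaugeField (F.P K) 0 (Matrix.specialUnitaryGroup (Fin 2) ℂ) | U' ∈ fibre F ℰp J K hJK V ∧ U' ∈ histGood F ℰp (θBal F.L γ b₀ p₀) K J ∧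
            wilsonAction4 U' = minActionRegPr F J K hJK ε₀ V},
        ∀ U ∈ fibre F ℰp J K hJK V, U ∈ histGood F ℰp (θBal F.L γ b₀ p₀) K J →
          (∀ w' : GaugeTransf (F.P K) 0 (Matrix.specialUnitaryGroup (Fin 2) ℂ),
            (∀ U' : GaugeField (F.P K) 0 (Matrix.specialUnitaryGroup (Fin 2) ℂ),
              descendTo F ℰp J K hJK (GaugeField.gaugeAct w' U') = descendTo F ℰp J K hJK U') →
            ∑ ℓ : PBond (F.P K) 0, dist1 (U ℓ * (U₀ ℓ)⁻¹) ^ 2 ≤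
              ∑ ℓ : PBond (F.P K) 0, dist1 (U ℓ * ((GaugeField.gaugeAct w' U₀) ℓ)⁻¹) ^ 2) →
          -(∑ p : Plaq (F.P K) 0,
              inner ℝ (imVec (su2Quat (GaugeField.plaqHol U₀ p))) (imVec (su2Quat ((GaugeField.plaqHol U₀ p)⁻¹ * GaugeField.plaqHol U p))))
            ≤ c * (((F.L : ℝ)⁻¹) ^ (2 * (K - J)) * ∑ ℓ : PBond (F.P K) 0, dist1 (U ℓ * (U₀ ℓ)⁻¹) ^ 2) +
              1 / 4 * ∑ p : Plaq (F.P K) 0, (1 - reTr ((GaugeField.plaqHol U₀ p)⁻¹ * GaugeField.plaqHol U p))) :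
    ∀ (L : ℕ), ∃ c₀ : ℝ, 0 < c₀ ∧ c₀ ≤ 1 ∧ ∀ (cw : ℝ), 0 < cw → cw ≤ c₀ → ∃ pS : ℝ, ∀ (b₀ p₀ : ℝ), 0 < b₀ → pS ≤ p₀ → 0 < p₀ → ∃ ε₁ : ℝ, 0 < ε₁ ∧ ∀ (ε₀ : ℝ), 0 < ε₀ → ε₀ ≤ ε₁ →
    ∃ γ₁ : ℝ, 0 < γ₁ ∧ ∃ μ : ℝ, 0 < μ ∧ ∀ (F : T3Family) (γ : ℝ), F.L = L → 0 < γ → γ ≤ γ₁ →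
      ∀ (J K : ℕ) (hJK : J ≤ K) (V : GaugeField (F.P J) 0 (Matrix.specialUnitaryGroup (Fin 2) ℂ)), PlaqSmall (θBal F.L γ (cw * b₀) p₀ J) V →
        ∀ U₀ ∈ {U' : GaugeField (F.P K) 0 (Matrix.specialUnitaryGroup (Fin 2) ℂ) | U' ∈ fibre F ℰp J K hJK V ∧ U' ∈ histGood F ℰp (θBal F.L γ b₀ p₀) K J ∧
            wilsonAction4 U' = minActionRegPr F J K hJK ε₀ V},
        ∀ U ∈ fibre F ℰp J K hJK V, U ∈ histGood F ℰp (θBal F.L γ b₀ p₀) K J →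
          μ * ((F.L : ℝ)⁻¹) ^ (2 * (K - J)) *
              (⨅ w : {w : GaugeTransf (F.P K) 0 (Matrix.specialUnitaryGroup (Fin 2) ℂ) | ∀ U : GaugeField (F.P K) 0 (Matrix.specialUnitaryGroup (Fin 2) ℂ),
                  descendTo F ℰp J K hJK (GaugeField.gaugeAct w U) = descendTo F ℰp J K hJK U}, ∑ ℓ : PBond (F.P K) 0,
                dist1 (U ℓ * ((GaugeField.gaugeAct (w : GaugeTransf (F.P K) 0 (Matrix.specialUnitaryGroup (Fin 2) ℂ)) U₀) ℓ)⁻¹) ^ 2)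
            ≤ wilsonAction4 U - minActionRegPr F J K hJK ε₀ V :=
  uniformFibreGapOrbit_of_strata
    (gapStratum_of_axialLetters
      (fun F J V =>
      (∀ c : Site (F.P J) 0 → Matrix (Fin 2) (Fin 2) ℂ,
      (∀ e : PBond (F.P J) 0, c e.src = ((unitsField (toUField V) e : (Matrix (Fin 2) (Fin 2) ℂ)ˣ) : Matrix (Fin 2) (Fin 2) ℂ) * c e.tgt *
      (((unitsField (toUField V) e)⁻¹ : (Matrix (Fin 2) (Fin 2) ℂ)ˣ) : Matrix (Fin 2) (Fin 2) ℂ)) →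
      ∃ z : ℂ, ∀ y, c y = z • (1 : Matrix (Fin 2) (Fin 2) ℂ)))
      (fun F J K hJK U U₀' => ∀ w : GaugeTransf (F.P K) 0 (Matrix.specialUnitaryGroup (Fin 2) ℂ),
        (∀ U' : GaugeField (F.P K) 0 (Matrix.specialUnitaryGroup (Fin 2) ℂ),
          descendTo F ℰp J K hJK (GaugeField.gaugeAct w U') = descendTo F ℰp J K hJK U') →
        ∑ ℓ : PBond (F.P K) 0, dist1 (U ℓ * (U₀' ℓ)⁻¹) ^ 2 ≤
          ∑ ℓ : PBond (F.P K) 0, dist1 (U ℓ * ((GaugeField.gaugeAct w U₀') ℓ)⁻¹) ^ 2)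
      (axLetter_opt _) hD₁ hF₁)
    (gapStratum_of_axialLetters
      (fun F J V =>
      (∃ g : GaugeTransf (F.P J) 0 (Matrix.specialUnitaryGroup (Fin 2) ℂ),
      (∀ e : PBond (F.P J) 0, Commute (((GaugeField.gaugeAct g V) e : Matrix.specialUnitaryGroup (Fin 2) ℂ) : Matrix (Fin 2) (Fin 2) ℂ) σ₃) ∧
      ∀ c : Site (F.P J) 0 → Matrix (Fin 2) (Fin 2) ℂ,
      (∀ e : PBond (F.P J) 0, c e.src = ((unitsField (toUField (GaugeField.gaugeAct g V)) e : (Matrix (Fin 2) (Fin 2) ℂ)ˣ) : Matrix (Fin 2) (Fin 2) ℂ) * c e.tgt *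
      (((unitsField (toUField (GaugeField.gaugeAct g V)) e)⁻¹ : (Matrix (Fin 2) (Fin 2) ℂ)ˣ) : Matrix (Fin 2) (Fin 2) ℂ)) →
      ∃ c₀ : Matrix (Fin 2) (Fin 2) ℂ, (∀ y, c y = c₀) ∧ Commute c₀ σ₃))
      (fun F J K hJK U U₀' => ∀ w : GaugeTransf (F.P K) 0 (Matrix.specialUnitaryGroup (Fin 2) ℂ),
        (∀ U' : GaugeField (F.P K) 0 (Matrix.specialUnitaryGroup (Fin 2) ℂ),
          descendTo F ℰp J K hJK (GaugeField.gaugeAct w U') = descendTo F ℰp J K hJK U') →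
        ∑ ℓ : PBond (F.P K) 0, dist1 (U ℓ * (U₀' ℓ)⁻¹) ^ 2 ≤
          ∑ ℓ : PBond (F.P K) 0, dist1 (U ℓ * ((GaugeField.gaugeAct w U₀') ℓ)⁻¹) ^ 2)
      (axLetter_opt _) hD₂ hF₂)

end Summit.QuantumFields.YangMills.Theorems.FluctuationComparisonRegPrIntLS2BetaStrataOfAxialLetters

end
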